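import Summits.AtomisticToContinuum.Crystallization.Theorems.PalmUnimodularRigidityLayeredLawsSelectHcpCorrMeanZeroPrelude
import Summits.AtomisticToContinuum.Crystallization.Theorems.PalmUnimodularRigidityLayeredLawsSelectHcpIterIntCount
import Summits.AtomisticToContinuum.Crystallization.Theorems.PalmUnimodularRigidityLayeredLawsSelectHcpMeasurableIterInt

/-!
# Crux `LayeredLawsSelectHcp` (stmt-AtomisticToContinuum-9226), line `mtp-prestress-split-ergodic-frame`:
# directed orbit-sum correctors have zero mean (assembly of the registered stub `stub_correctorMeanZero`)

Lead c2, cycle 3.  The registered stub `stub_correctorMeanZero` of the reshaped skeleton: for a NEAR-admissible datum `d` (shift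
`c ∈ nearBall`, functional `φ = ψ ∘ (restriction to nearBall)`, `ψ` measurable, `|φ| ≤ C`) and a point-stationary hcp-layered
probability law `P`, `corrector d` is `P`-integrable with mean zero.  Proof: the Mecke transport SURROGATE
`g(μ, y) = coef · iterInt κ nearBall.toList (chartWeight ĉ ψ y) ((κ μ).map (· − y)) 0` (`ĉ = −c`/`c` on even/odd layers; `κ` the
s-finite kernel equal to the identity on locally finite configurations, `exists_isSFiniteKernel_apply_eq_self`) is jointly measurable
(`tube_measurable_iterIntK`), and on the almost-sure event (sample `= count|S`, `S` a rooted hcp-charted tube configuration with hard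
core) its sent mass is `coef · Σ_{X ∈ RC(S)} φ (reRoot X c)` and its received mass is `coef · Σ_{X ∈ RC(S)} φ X`
(`tube_iterInt_count_eq_chartSum` on `S − y` and on `S`, the landed fibre identities `tube_corrector_received_identity` /
`tube_corrector_sent_identity` with `(ĉ, φ ∘ reRoot(·, c))` and the involution `tube_reRoot_involution`); both are bounded by
`12·|coef|·C` (twelve charts, `tube_rootedCharts_ncard`), so `tube_correctorMeanZero_of` (the signed Mecke identity) applies.
The assembly is first proved modulo the two analytic inputs as `correctorMeanZero_core`.
-/

noncomputable section

namespace Summit.AtomisticToContinuum.Crystallization.Theorems.PalmUnimodularRigidity.LayeredLawsSelectHcp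

open MeasureTheory Set ProbabilityTheory
open scoped ENNReal
open Literature.MathematicalPhysics.StatisticalMechanics Literature.Geometry.DiscreteGeometry
open Summit.AtomisticToContinuum.Crystallization.Theorems.LayeredLawsSelectHcp.Negative.DiracLaws
  (PointStationary GoodShell Layered BarlowLike)
open Summit.AtomisticToContinuum.Crystallization.Theorems.LayeredLawsSelectHcp.Negative.RootedRedundant
  (rooted_of_pointStationary_layered)
open Summit.AtomisticToContinuum.Crystallization.Theorems.LayeredLawsSelectHcp.Negative.FccModel
  (set_eq_of_count_restrict_eq)
open Summit.AtomisticToContinuum.Crystallization.Theorems.LayeredLawsSelectHcp.Negative.PeriodicEnergy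
  (goodShell_image_sub)
open Summit.AtomisticToContinuum.Crystallization.Theorems.LayeredLawsSelectHcp.Negative.PeriodicPalmLaw
  (map_count_restrict_image)

/-! ## The assembly modulo W-B and W-C -/

/-- **`stub_correctorMeanZero` from the counting evaluation (W-B) and the measurability (W-C) of the iterated-integral surrogate.**
[cite: LastPenrose2017, Theorem 9.4] -/
theorem correctorMeanZero_core
    (hB : ∀ S : Set (EuclideanSpace ℝ (Fin 3)), (0 : EuclideanSpace ℝ (Fin 3)) ∈ S → (∀ x ∈ S, GoodShell S x) → HcpCharted S → ∀ (κ : ProbabilityTheory.Kernel (MeasureTheory.Measure (EuclideanSpace ℝ (Fin 3))) (EuclideanSpace ℝ (Fin 3))), κ ((MeasureTheory.Measure.count : MeasureTheory.Measure (EuclideanSpace ℝ (Fin 3))).restrict S) = (MeasureTheory.Measure.count : MeasureTheory.Measure (EuclideanSpace ℝ (Fin 3))).restrict S → ∀ (e : ℤ × ℤ × ℤ), e ∈ nearBall → ∀ (ψ : (↥nearBall → EuclideanSpace ℝ (Fin 3)) → ℝ) (y : EuclideanSpace ℝ (Fin 3)), iterInt κ nearBall.toList (chartWeight e ψ y) ((MeasureTheory.Measure.count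 : MeasureTheory.Measure (EuclideanSpace ℝ (Fin 3))).restrict S) 0 = ∑ᶠ X ∈ {X : ℤ × ℤ × ℤ → EuclideanSpace ℝ (Fin 3) | IsRootedChart S X ∧ X e = -y}, ψ (fun u => X u))
    (hCK : ∀ (κ : ProbabilityTheory.Kernel (MeasureTheory.Measure (EuclideanSpace ℝ (Fin 3))) (EuclideanSpace ℝ (Fin 3))), ProbabilityTheory.IsSFiniteKernel κ → ∀ (e : ℤ × ℤ × ℤ) (ψ : (↥nearBall → EuclideanSpace ℝ (Fin 3)) → ℝ), Measurable ψ → ∀ L : List (ℤ × ℤ × ℤ), Measurable (fun p : MeasureTheory.Measure (EuclideanSpace ℝ (Fin 3)) × EuclideanSpace ℝ (Fin 3) => iterInt κ L (chartWeight e ψ p.2) (MeasureTheory.Measure.map (fun z => z - p.2) (κ p.1)) 0)) :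
    ∀ d : CorrDatum, d.NearAdmissible →
      ∀ P : Measure (Measure (EuclideanSpace ℝ (Fin 3))), IsProbabilityMeasure P → PointStationary P → HcpLayered P →
        Integrable (corrector d) P ∧ ∫ μ, corrector d μ ∂P = 0 := by
  intro d hd P hP hstat hHcp
  obtain ⟨hc, ψ, C, hψ, hφ, hCb⟩ := hd
  obtain ⟨e, he_def⟩ : ∃ e : ℤ × ℤ × ℤ, e = (if Even d.shift.1 then -d.shift else d.shift) := ⟨_, rfl⟩
  have he : e ∈ nearBall := by rw [he_def]; exact hat_mem_nearBall d.shift hc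
  -- the s-finite surrogate of the identity kernel on locally finite configurations
  obtain ⟨κ, hκ, hκid⟩ := Literature.Probability.Process.exists_isSFiniteKernel_apply_eq_self
    (fun n : ℕ => (fun z : EuclideanSpace ℝ (Fin 3) => ⌊‖z‖⌋₊) ⁻¹' {n}) (fun n => measurableSet_floorNorm_preimage n)
    (fun m n hmn => Set.disjoint_left.2 fun z (hz : ⌊‖z‖⌋₊ ∈ ({m} : Set ℕ)) (hz' : ⌊‖z‖⌋₊ ∈ ({n} : Set ℕ)) =>
      hmn ((Set.mem_singleton_iff.1 hz).symm.trans (Set.mem_singleton_iff.1 hz')))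
    (fun z => ⟨⌊‖z‖⌋₊, rfl⟩)
  haveI := hκ
  -- the transport surrogate
  set g : Measure (EuclideanSpace ℝ (Fin 3)) → EuclideanSpace ℝ (Fin 3) → ℝ := fun μ y =>
    d.coef * iterInt κ nearBall.toList (chartWeight e ψ y) (Measure.map (fun z => z - y) (κ μ)) 0 with hg_def
  have hgm : Measurable (Function.uncurry g) := by
    have h := hCK κ hκ e ψ hψ nearBall.toList
    exact measurable_const.mul h
  -- a.s. structure of the samples
  have hLay : Layered P := by
    filter_upwards [hHcp] with μ hμ
    obtain ⟨S, h1, h2, h3⟩ := hμ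
    exact ⟨S, h1, h2, alternatingHagg, isHaggSeq_alternating, h3⟩
  have hRoot := rooted_of_pointStationary_layered hstat hLay
  have hgood : ∀ᵐ μ ∂P, ∃ S : Set (EuclideanSpace ℝ (Fin 3)),
      μ = (Measure.count : Measure (EuclideanSpace ℝ (Fin 3))).restrict S ∧ (0 : EuclideanSpace ℝ (Fin 3)) ∈ S ∧
        (∀ x ∈ S, GoodShell S x) ∧ HcpCharted S ∧
        (∀ x ∈ S, ∀ x' ∈ S, x ≠ x' → (891 / 1000 : ℝ) ≤ dist x x') := by
    filter_upwards [hHcp, hRoot] with μ hH hR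
    obtain ⟨S, hμ, hg, hch⟩ := hH
    obtain ⟨S', h0', hsep', hμ'⟩ := hR
    have hSS' : S = S' := set_eq_of_count_restrict_eq (hμ.symm.trans hμ')
    subst hSS'
    exact ⟨S, hμ, h0', hg, hch, hsep'⟩
  -- local finiteness of separated configurations and the kernel acting as the identity on them
  have locfin : ∀ {S : Set (EuclideanSpace ℝ (Fin 3))}, (∀ x ∈ S, ∀ x' ∈ S, x ≠ x' → (891 / 1000 : ℝ) ≤ dist x x') →
      ∀ n : ℕ, (Measure.count : Measure (EuclideanSpace ℝ (Fin 3))).restrict S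
        ((fun z : EuclideanSpace ℝ (Fin 3) => ⌊‖z‖⌋₊) ⁻¹' {n}) < ⊤ :=
    fun hsep n => count_restrict_floorNorm_preimage_lt_top (by norm_num : (0 : ℝ) < 891 / 1000) hsep n
  have hlf : ∀ᵐ μ ∂P, ∀ n : ℕ, μ ((fun z : EuclideanSpace ℝ (Fin 3) => ⌊‖z‖⌋₊) ⁻¹' {n}) < ⊤ := by
    filter_upwards [hgood] with μ hμ
    obtain ⟨S, hμS, -, -, -, hsep⟩ := hμ
    rw [hμS]; exact locfin hsep
  -- finiteness of chart sets
  have hfinRC : ∀ᵐ μ ∂P, (rootedCharts μ).Finite := by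
    filter_upwards [hgood] with μ hμ
    obtain ⟨S, hμS, h0, hg, hch, -⟩ := hμ
    rw [hμS]; exact (tube_rootedCharts_ncard S h0 hg hch).1
  ------------------------------------------------------------------------------------------------
  -- THE TWO COUNTING EVALUATIONS on a rooted hcp-charted tube configuration `S`
  ------------------------------------------------------------------------------------------------
  have evalSent : ∀ S : Set (EuclideanSpace ℝ (Fin 3)), (∀ x ∈ S, GoodShell S x) → HcpCharted S →
      (∀ x ∈ S, ∀ x' ∈ S, x ≠ x' → (891 / 1000 : ℝ) ≤ dist x x') → ∀ y ∈ S,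
      g ((Measure.count : Measure (EuclideanSpace ℝ (Fin 3))).restrict S) y =
        d.coef * ∑ᶠ Ψ ∈ {Ψ : ℤ × ℤ × ℤ → EuclideanSpace ℝ (Fin 3) |
          IsRootedChart ((fun z : EuclideanSpace ℝ (Fin 3) => z - y) '' S) Ψ ∧ Ψ e = -y}, d.φ Ψ := by
    intro S hg hch hsep y hy
    obtain ⟨h0', hg', hch'⟩ := good_image_sub hg hch hy
    have hsep' := separated_image_sub hsep y
    have hcount : S.Countable := hcpCharted_countable' hch
    simp only [hg_def]
    rw [hκid _ (locfin hsep), map_sub_count_restrict hcount y,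
      hB _ h0' hg' hch' κ (hκid _ (locfin hsep')) e he ψ y]
    congr 1
    exact finsum_mem_congr rfl fun X _ => (hφ X).symm
  have evalRecv : ∀ S : Set (EuclideanSpace ℝ (Fin 3)), (0 : EuclideanSpace ℝ (Fin 3)) ∈ S → (∀ x ∈ S, GoodShell S x) →
      HcpCharted S → (∀ x ∈ S, ∀ x' ∈ S, x ≠ x' → (891 / 1000 : ℝ) ≤ dist x x') → ∀ y : EuclideanSpace ℝ (Fin 3),
      g (Measure.map (fun z => z - y) ((Measure.count : Measure (EuclideanSpace ℝ (Fin 3))).restrict S)) (-y) =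
        d.coef * ∑ᶠ X ∈ {X : ℤ × ℤ × ℤ → EuclideanSpace ℝ (Fin 3) | IsRootedChart S X ∧ X e = y}, d.φ X := by
    intro S h0 hg hch hsep y
    have hcount : S.Countable := hcpCharted_countable' hch
    have hsep' := separated_image_sub hsep y
    simp only [hg_def]
    rw [map_sub_count_restrict hcount y, hκid _ (locfin hsep'), ← map_sub_count_restrict hcount y, map_sub_neg_map_sub,
      hB S h0 hg hch κ (hκid _ (locfin hsep)) e he ψ (-y)]
    simp only [neg_neg]
    congr 1
    exact finsum_mem_congr rfl fun X _ => (hφ X).symm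
  ------------------------------------------------------------------------------------------------
  -- finite fibre sets and their bounds
  ------------------------------------------------------------------------------------------------
  have hC0 : 0 ≤ C := le_trans (abs_nonneg _) (hCb 0)
  -- the finitely supported versions of the two one-sided transports on a good `S`
  have sentFun : ∀ S : Set (EuclideanSpace ℝ (Fin 3)), (0 : EuclideanSpace ℝ (Fin 3)) ∈ S → (∀ x ∈ S, GoodShell S x) →
      HcpCharted S → (∀ x ∈ S, ∀ x' ∈ S, x ≠ x' → (891 / 1000 : ℝ) ≤ dist x x') →
      let F : EuclideanSpace ℝ (Fin 3) → ℝ := fun y => d.coef * ∑ᶠ Ψ ∈ {Ψ : ℤ × ℤ × ℤ → EuclideanSpace ℝ (Fin 3) |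
          IsRootedChart ((fun z : EuclideanSpace ℝ (Fin 3) => z - y) '' S) Ψ ∧ Ψ e = -y}, d.φ Ψ
      (Function.support F ⊆ (fun X : ℤ × ℤ × ℤ → EuclideanSpace ℝ (Fin 3) => X d.shift) ''
          {X : ℤ × ℤ × ℤ → EuclideanSpace ℝ (Fin 3) | IsRootedChart S X}) ∧
      (∀ y, |F y| ≤ |d.coef| * (12 * C)) ∧
      (∑ᶠ y ∈ S, F y = d.coef * ∑ᶠ X ∈ {X : ℤ × ℤ × ℤ → EuclideanSpace ℝ (Fin 3) | IsRootedChart S X},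
          d.φ (reRoot X d.shift)) := by
    intro S h0 hg hch hsep F
    have hfin := (finite_isRootedChart h0 hg hch).1
    refine ⟨?_, ?_, ?_⟩
    · intro y hy
      rw [Function.mem_support] at hy
      have hne : {Ψ : ℤ × ℤ × ℤ → EuclideanSpace ℝ (Fin 3) |
          IsRootedChart ((fun z : EuclideanSpace ℝ (Fin 3) => z - y) '' S) Ψ ∧ Ψ e = -y}.Nonempty := by
        by_contra hem
        rw [Set.not_nonempty_iff_eq_empty] at hem
        apply hy
        simp only [F, hem, finsum_mem_empty, mul_zero]
      obtain ⟨Ψ, hΨ, hΨe⟩ := hne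
      refine ⟨reRoot Ψ e, isRootedChart_reRoot_of_apply_eq_neg hΨ hΨe, ?_⟩
      show reRoot Ψ e d.shift = y
      have h1 : labelShift e d.shift = 0 := by rw [he_def]; exact labelShift_inv_apply_self d.shift
      simp only [reRoot, h1, hΨ.1, hΨe, zero_sub, neg_neg]
    · intro y
      simp only [F, abs_mul]
      refine mul_le_mul_of_nonneg_left ?_ (abs_nonneg _)
      by_cases hyS : y ∈ S
      · obtain ⟨h0', hg', hch'⟩ := good_image_sub hg hch hyS
        have hf' := finite_isRootedChart h0' hg' hch'
        have hsub : {Ψ : ℤ × ℤ × ℤ → EuclideanSpace ℝ (Fin 3) |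
            IsRootedChart ((fun z : EuclideanSpace ℝ (Fin 3) => z - y) '' S) Ψ ∧ Ψ e = -y} ⊆
            {Ψ : ℤ × ℤ × ℤ → EuclideanSpace ℝ (Fin 3) | IsRootedChart ((fun z : EuclideanSpace ℝ (Fin 3) => z - y) '' S) Ψ} :=
          fun Ψ hΨ => hΨ.1
        exact abs_finsum_mem_le (hf'.1.subset hsub) ((Set.ncard_le_ncard hsub hf'.1).trans hf'.2.le) hCb
      · have hem : {Ψ : ℤ × ℤ × ℤ → EuclideanSpace ℝ (Fin 3) |
            IsRootedChart ((fun z : EuclideanSpace ℝ (Fin 3) => z - y) '' S) Ψ ∧ Ψ e = -y} = ∅ := by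
          ext Ψ
          simp only [Set.mem_setOf_eq, Set.mem_empty_iff_false, iff_false, not_and]
          intro hΨ _
          exact hyS (mem_of_isRootedChart_image_sub hΨ)
        rw [hem, finsum_mem_empty, abs_zero]
        positivity
    · have hfin' : ∀ y ∈ S, {Ψ : ℤ × ℤ × ℤ → EuclideanSpace ℝ (Fin 3) |
          IsRootedChart ((fun z : EuclideanSpace ℝ (Fin 3) => z - y) '' S) Ψ}.Finite := by
        intro y hy
        obtain ⟨h0', hg', hch'⟩ := good_image_sub hg hch hy
        exact (finite_isRootedChart h0' hg' hch').1
      have hid := tube_corrector_received_identity S hfin hfin' (fun X => d.φ (reRoot X d.shift)) e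
      simp only [F]
      rw [← mul_finsum_mem, ← hid]
      congr 1
      refine finsum_mem_congr rfl fun y _ => ?_
      refine finsum_mem_congr rfl fun Ψ hΨ => ?_
      show d.φ Ψ = d.φ (reRoot (reRoot Ψ e) d.shift)
      rw [he_def, tube_reRoot_involution Ψ hΨ.1.1 d.shift]
  have recvFun : ∀ S : Set (EuclideanSpace ℝ (Fin 3)), (0 : EuclideanSpace ℝ (Fin 3)) ∈ S → (∀ x ∈ S, GoodShell S x) →
      HcpCharted S →
      let G : EuclideanSpace ℝ (Fin 3) → ℝ := fun y => d.coef * ∑ᶠ X ∈ {X : ℤ × ℤ × ℤ → EuclideanSpace ℝ (Fin 3) |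
          IsRootedChart S X ∧ X e = y}, d.φ X
      (Function.support G ⊆ (fun X : ℤ × ℤ × ℤ → EuclideanSpace ℝ (Fin 3) => X e) ''
          {X : ℤ × ℤ × ℤ → EuclideanSpace ℝ (Fin 3) | IsRootedChart S X}) ∧
      (∀ y, |G y| ≤ |d.coef| * (12 * C)) ∧
      (∑ᶠ y ∈ S, G y = d.coef * ∑ᶠ X ∈ {X : ℤ × ℤ × ℤ → EuclideanSpace ℝ (Fin 3) | IsRootedChart S X}, d.φ X) := by
    intro S h0 hg hch G
    have hfin := finite_isRootedChart h0 hg hch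
    refine ⟨?_, ?_, ?_⟩
    · intro y hy
      rw [Function.mem_support] at hy
      have hne : {X : ℤ × ℤ × ℤ → EuclideanSpace ℝ (Fin 3) | IsRootedChart S X ∧ X e = y}.Nonempty := by
        by_contra hem
        rw [Set.not_nonempty_iff_eq_empty] at hem
        apply hy
        simp only [G, hem, finsum_mem_empty, mul_zero]
      obtain ⟨X, hX, hXe⟩ := hne
      exact ⟨X, hX, hXe⟩
    · intro y
      simp only [G, abs_mul]
      refine mul_le_mul_of_nonneg_left ?_ (abs_nonneg _)
      have hsub : {X : ℤ × ℤ × ℤ → EuclideanSpace ℝ (Fin 3) | IsRootedChart S X ∧ X e = y} ⊆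
          {X : ℤ × ℤ × ℤ → EuclideanSpace ℝ (Fin 3) | IsRootedChart S X} := fun X hX => hX.1
      exact abs_finsum_mem_le (hfin.1.subset hsub) ((Set.ncard_le_ncard hsub hfin.1).trans hfin.2.le) hCb
    · have hid := tube_corrector_sent_identity S hfin.1 (fun X => d.φ (reRoot X d.shift)) e
      simp only [G]
      rw [← mul_finsum_mem]
      congr 1
      have hl : ∑ᶠ y ∈ S, ∑ᶠ X ∈ {X : ℤ × ℤ × ℤ → EuclideanSpace ℝ (Fin 3) | IsRootedChart S X ∧ X e = y}, d.φ X =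
          ∑ᶠ y ∈ S, ∑ᶠ X ∈ {X : ℤ × ℤ × ℤ → EuclideanSpace ℝ (Fin 3) | IsRootedChart S X ∧ X e = y},
            (fun X => d.φ (reRoot X d.shift)) (reRoot X e) := by
        refine finsum_mem_congr rfl fun y _ => finsum_mem_congr rfl fun X hX => ?_
        show d.φ X = d.φ (reRoot (reRoot X e) d.shift)
        rw [he_def, tube_reRoot_involution X hX.1.1 d.shift]
      have hr : ∑ᶠ X ∈ {X : ℤ × ℤ × ℤ → EuclideanSpace ℝ (Fin 3) | IsRootedChart S X}, d.φ X =
          ∑ᶠ X ∈ {X : ℤ × ℤ × ℤ → EuclideanSpace ℝ (Fin 3) | IsRootedChart S X},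
            (fun X => d.φ (reRoot X d.shift)) (reRoot X e) := by
        refine finsum_mem_congr rfl fun X hX => ?_
        show d.φ X = d.φ (reRoot (reRoot X e) d.shift)
        rw [he_def, tube_reRoot_involution X hX.1 d.shift]
      rw [hl, hr, hid]
  ------------------------------------------------------------------------------------------------
  -- the a.e. one-sided transports
  ------------------------------------------------------------------------------------------------
  have hbound_chart : ∀ S : Set (EuclideanSpace ℝ (Fin 3)), (0 : EuclideanSpace ℝ (Fin 3)) ∈ S → (∀ x ∈ S, GoodShell S x) →
      HcpCharted S → ∀ θ : (ℤ × ℤ × ℤ → EuclideanSpace ℝ (Fin 3)) → ℝ, (∀ X, |θ X| ≤ C) →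
      |d.coef * ∑ᶠ X ∈ {X : ℤ × ℤ × ℤ → EuclideanSpace ℝ (Fin 3) | IsRootedChart S X}, θ X| ≤ |d.coef| * (12 * C) := by
    intro S h0 hg hch θ hθ
    have hfin := finite_isRootedChart h0 hg hch
    rw [abs_mul]
    exact mul_le_mul_of_nonneg_left (abs_finsum_mem_le hfin.1 hfin.2.le hθ) (abs_nonneg _)
  have hsend : ∀ᵐ μ ∂P, ∫ y, g μ y ∂μ = d.coef * ∑ᶠ X ∈ rootedCharts μ, d.φ (reRoot X d.shift) := by
    filter_upwards [hgood] with μ hμ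
    obtain ⟨S, hμS, h0, hg, hch, hsep⟩ := hμ
    obtain ⟨hsupp, -, hsum⟩ := sentFun S h0 hg hch hsep
    have hSm : MeasurableSet S := (hcpCharted_countable' hch).measurableSet
    have hfinS : (Function.support fun y => d.coef * ∑ᶠ Ψ ∈ {Ψ : ℤ × ℤ × ℤ → EuclideanSpace ℝ (Fin 3) |
        IsRootedChart ((fun z : EuclideanSpace ℝ (Fin 3) => z - y) '' S) Ψ ∧ Ψ e = -y}, d.φ Ψ).Finite :=
      ((finite_isRootedChart h0 hg hch).1.image _).subset hsupp
    rw [hμS, rootedCharts_count_restrict, ← hsum,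
      ← tube_integral_count_restrict_of_finite_support S _ (IterIntCount.measurable_of_finite_support hfinS) (hfinS.inter_of_right S)]
    refine setIntegral_congr_fun hSm fun y hy => ?_
    exact evalSent S hg hch hsep y hy
  have hrecv : ∀ᵐ μ ∂P, ∫ y, g (Measure.map (fun z => z - y) μ) (-y) ∂μ = d.coef * ∑ᶠ X ∈ rootedCharts μ, d.φ X := by
    filter_upwards [hgood] with μ hμ
    obtain ⟨S, hμS, h0, hg, hch, hsep⟩ := hμ
    obtain ⟨hsupp, -, hsum⟩ := recvFun S h0 hg hch
    have hSm : MeasurableSet S := (hcpCharted_countable' hch).measurableSet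
    have hfinS : (Function.support fun y => d.coef * ∑ᶠ X ∈ {X : ℤ × ℤ × ℤ → EuclideanSpace ℝ (Fin 3) |
        IsRootedChart S X ∧ X e = y}, d.φ X).Finite :=
      ((finite_isRootedChart h0 hg hch).1.image _).subset hsupp
    rw [hμS, rootedCharts_count_restrict, ← hsum,
      ← tube_integral_count_restrict_of_finite_support S _ (IterIntCount.measurable_of_finite_support hfinS) (hfinS.inter_of_right S)]
    refine setIntegral_congr_fun hSm fun y _ => ?_
    exact evalRecv S h0 hg hch hsep y
  ------------------------------------------------------------------------------------------------
  -- finiteness of the double `‖·‖ₑ` integral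
  ------------------------------------------------------------------------------------------------
  have hfin : ∫⁻ μ, ∫⁻ y, ‖g μ y‖ₑ ∂μ ∂P ≠ ⊤ := by
    have hK : ∀ᵐ μ ∂P, ∫⁻ y, ‖g μ y‖ₑ ∂μ ≤ ENNReal.ofReal (|d.coef| * (12 * C)) * 12 := by
      filter_upwards [hgood] with μ hμ
      obtain ⟨S, hμS, h0, hg, hch, hsep⟩ := hμ
      obtain ⟨hsupp, hbd, -⟩ := sentFun S h0 hg hch hsep
      have hfinRC' := finite_isRootedChart h0 hg hch
      have hSm : MeasurableSet S := (hcpCharted_countable' hch).measurableSet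
      set T : Set (EuclideanSpace ℝ (Fin 3)) := (fun X : ℤ × ℤ × ℤ → EuclideanSpace ℝ (Fin 3) => X d.shift) ''
        {X : ℤ × ℤ × ℤ → EuclideanSpace ℝ (Fin 3) | IsRootedChart S X} with hT
      have hTfin : T.Finite := hfinRC'.1.image _
      have hTcard : hTfin.toFinset.card ≤ 12 := by
        rw [← Set.ncard_eq_toFinset_card T hTfin, ← hfinRC'.2]
        exact Set.ncard_image_le hfinRC'.1
      rw [hμS]
      calc ∫⁻ y, ‖g ((Measure.count : Measure (EuclideanSpace ℝ (Fin 3))).restrict S) y‖ₑ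
              ∂(Measure.count : Measure (EuclideanSpace ℝ (Fin 3))).restrict S
          ≤ ∫⁻ y, T.indicator (fun _ => ENNReal.ofReal (|d.coef| * (12 * C))) y
              ∂(Measure.count : Measure (EuclideanSpace ℝ (Fin 3))).restrict S := by
            refine setLIntegral_mono' hSm fun y hy => ?_
            rw [evalSent S hg hch hsep y hy]
            by_cases hyT : y ∈ T
            · rw [Set.indicator_of_mem hyT, Real.enorm_eq_ofReal_abs]
              exact ENNReal.ofReal_le_ofReal (hbd y)
            · have h0' : d.coef * ∑ᶠ Ψ ∈ {Ψ : ℤ × ℤ × ℤ → EuclideanSpace ℝ (Fin 3) |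
                  IsRootedChart ((fun z : EuclideanSpace ℝ (Fin 3) => z - y) '' S) Ψ ∧ Ψ e = -y}, d.φ Ψ = 0 := by
                by_contra hne
                exact hyT (hsupp (Function.mem_support.2 hne))
              rw [h0', Set.indicator_of_notMem hyT, enorm_zero]
        _ = ENNReal.ofReal (|d.coef| * (12 * C)) * (Measure.count : Measure (EuclideanSpace ℝ (Fin 3))).restrict S T := by
            rw [lintegral_indicator_const hTfin.measurableSet]
        _ ≤ ENNReal.ofReal (|d.coef| * (12 * C)) * 12 := by
            gcongr
            calc (Measure.count : Measure (EuclideanSpace ℝ (Fin 3))).restrict S T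
                ≤ (Measure.count : Measure (EuclideanSpace ℝ (Fin 3))) T := Measure.restrict_apply_le _ _
              _ = hTfin.toFinset.card := Measure.count_apply_finite T hTfin
              _ ≤ 12 := by exact_mod_cast hTcard
    refine ne_top_of_le_ne_top (b := ∫⁻ _μ, ENNReal.ofReal (|d.coef| * (12 * C)) * 12 ∂P) ?_ (lintegral_mono_ae hK)
    rw [lintegral_const, measure_univ, mul_one]
    exact ENNReal.mul_ne_top ENNReal.ofReal_ne_top (by norm_num)
  ------------------------------------------------------------------------------------------------
  -- integrability of the one-sided transports
  ------------------------------------------------------------------------------------------------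
  have hint1 : Integrable (fun μ => ∫ y, g μ y ∂μ) P := by
    have hSM : StronglyMeasurable fun μ : Measure (EuclideanSpace ℝ (Fin 3)) => ∫ y, g μ y ∂(κ μ) :=
      hgm.stronglyMeasurable.integral_kernel_prod_right' (κ := κ)
    have hae : (fun μ : Measure (EuclideanSpace ℝ (Fin 3)) => ∫ y, g μ y ∂(κ μ)) =ᵐ[P] fun μ => ∫ y, g μ y ∂μ := by
      filter_upwards [hlf] with μ hμ
      rw [hκid μ hμ]
    refine Integrable.mono' (integrable_const (|d.coef| * (12 * C))) (hSM.aestronglyMeasurable.congr hae) ?_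
    filter_upwards [hsend, hgood] with μ hμ hG
    obtain ⟨S, hμS, h0, hg, hch, -⟩ := hG
    rw [hμ, hμS, rootedCharts_count_restrict, Real.norm_eq_abs]
    exact hbound_chart S h0 hg hch (fun X => d.φ (reRoot X d.shift)) fun X => hCb _
  have hint2 : Integrable (fun μ => ∫ y, g (Measure.map (fun z => z - y) μ) (-y) ∂μ) P := by
    have hm2 : Measurable fun p : Measure (EuclideanSpace ℝ (Fin 3)) × EuclideanSpace ℝ (Fin 3) =>
        g (Measure.map (fun z => z - p.2) (κ p.1)) (-p.2) :=
      hgm.comp ((Literature.Probability.Process.measurable_map_sub_kernel κ).prodMk measurable_snd.neg)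
    have hSM : StronglyMeasurable fun μ : Measure (EuclideanSpace ℝ (Fin 3)) =>
        ∫ y, g (Measure.map (fun z => z - y) (κ μ)) (-y) ∂(κ μ) :=
      hm2.stronglyMeasurable.integral_kernel_prod_right' (κ := κ)
    have hae : (fun μ : Measure (EuclideanSpace ℝ (Fin 3)) => ∫ y, g (Measure.map (fun z => z - y) (κ μ)) (-y) ∂(κ μ)) =ᵐ[P]
        fun μ => ∫ y, g (Measure.map (fun z => z - y) μ) (-y) ∂μ := by
      filter_upwards [hlf] with μ hμ
      rw [hκid μ hμ]
    refine Integrable.mono' (integrable_const (|d.coef| * (12 * C))) (hSM.aestronglyMeasurable.congr hae) ?_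
    filter_upwards [hrecv, hgood] with μ hμ hG
    obtain ⟨S, hμS, h0, hg, hch, -⟩ := hG
    rw [hμ, hμS, rootedCharts_count_restrict, Real.norm_eq_abs]
    exact hbound_chart S h0 hg hch d.φ hCb
  exact tube_correctorMeanZero_of d P hstat hlf hfinRC g hgm hfin hsend hrecv hint1 hint2

/-! ## The registered stub -/

/-- **Registered stub `stub_correctorMeanZero` of the crux skeleton (line `mtp-prestress-split-ergodic-frame`) — DIRECTED ORBIT-SUM
CORRECTORS HAVE ZERO MEAN.**  For every near-admissible corrector datum and every point-stationary hcp-layered probability law, the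
corrector is integrable with zero mean: the assembly `correctorMeanZero_core` fed with the landed counting evaluation
`tube_iterInt_count_eq_chartSum` and measurability `tube_measurable_iterIntK` of the iterated-integral surrogate.
[cite: LastPenrose2017, Theorem 9.4] -/
theorem stub_correctorMeanZero :
    ∀ d : CorrDatum, d.NearAdmissible →
      ∀ P : Measure (Measure (EuclideanSpace ℝ (Fin 3))), IsProbabilityMeasure P → PointStationary P → HcpLayered P →
        Integrable (corrector d) P ∧ ∫ μ, corrector d μ ∂P = 0 :=
  correctorMeanZero_core tube_iterInt_count_eq_chartSum tube_measurable_iterIntK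

end Summit.AtomisticToContinuum.Crystallization.Theorems.PalmUnimodularRigidity.LayeredLawsSelectHcp

end
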